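import Summits.AtomisticToContinuum.Crystallization.Theorems.SquareWellLayerCakeGapTwelveToBarlowCombinatorialLayeringTransportSteps1
import Summits.AtomisticToContinuum.Crystallization.Theorems.SquareWellLayerCakeGapTwelveToBarlowCombinatorialLayeringTransportSteps2
import Summits.AtomisticToContinuum.Crystallization.Theorems.SquareWellLayerCakeGapTwelveToBarlowCombinatorialLayeringTransportSteps3
import Summits.AtomisticToContinuum.Crystallization.Theorems.SquareWellLayerCakeGapTwelveToBarlowCombinatorialLayeringTransportVinv
import Summits.AtomisticToContinuum.Crystallization.Theorems.SquareWellLayerCakeGapTwelveToBarlowCombinatorialLayeringTransportAttach1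
import Summits.AtomisticToContinuum.Crystallization.Theorems.SquareWellLayerCakeGapTwelveToBarlowCombinatorialLayeringTransportAttach2
import Summits.AtomisticToContinuum.Crystallization.Theorems.SquareWellLayerCakeGapTwelveToBarlowCombinatorialLayeringTransportComm1
import Summits.AtomisticToContinuum.Crystallization.Theorems.SquareWellLayerCakeGapTwelveToBarlowCombinatorialLayeringTransportVComm1

/-!
# Combinatorial layering (B1a of `GapTwelveToBarlow`): transport port, part `VComm2`

Crux `SquareWellLayerCake.GapTwelveToBarlow` (stmt-AtomisticToContinuum-15807), line `Sketch`,
stub `stub_combinatorialLayering`, residual `(H_develop)`.  PORT of the tree file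
`PalmUnimodularRigidityShellsToBarlowChartTransportVComm2.lean` (crux 9227) to GRADED COMBINATORIAL
charts, following the port rules recorded in `…CombinatorialLayeringTransportSteps1` (bundled
standing hypothesis `hch` on `S : ℕ → Set E3`, abstract bond relation `B`, memberships
`x ∈ S (n + k)`, transfer as an input).  Statements and proofs are otherwise those of the source,
whose documentation follows.

# Line `develop-the-model-growth-descent` (crux `ShellsToBarlowChart`, stmt-AtomisticToContinuum-9227): commutation of `V⁻¹` with `I` and `J` (part 2/3)

Helper lemmas for `stub_transportSystem` (the geometric half of the line): frames `⟨x, t₁, t₂, U⟩`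
read in the integer charts `IsZChart` of a good-shell configuration, their transports and the
coherence of the resulting development `frameAt`.  The only metric inputs are the chart transfer
lemma and `bond_nb_iff`; everything else is label combinatorics in `ℤ³` (pattern facts
`TransportPatterns*`).  All `[folklore]` (HalesDSP2012 §1.3 for the two kissing patterns).
-/

noncomputable section

namespace Summit.AtomisticToContinuum.Crystallization.Theorems.SquareWellLayerCakeGapTwelveToBarlow

open Literature.Geometry.DiscreteGeometry Literature.MathematicalPhysics.StatisticalMechanics
open Summit.AtomisticToContinuum.Crystallization.Theorems.PalmUnimodularRigidityShellsToBarlowChart hiding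
  IsZChart TransportSystem scales_tied sqNormInt_transfer bond_symm nb_mem zlab_spec zlab_nb
  bond_nb_iff pattern_cases transfer_nb_nb transfer_nb_centre transfer_nb_target
  sqNormInt_zlab_centre hcp_of_mirror_pair Istep_spec Jstep_spec IinvStep_spec JinvStep_spec
  capWithAny_of_mem_cap IinvStep_Istep Istep_IinvStep JinvStep_Jstep Jstep_JinvStep polar_at_apex
  onesided_at_apex Vstep_spec nb_inj Istep_lower Jstep_lower IinvStep_lower JinvStep_lower
  polar_at_lower_apex onesided_at_lower_apex VinvStep_spec attach_I_even attach_I_odd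
  attach_lower_I_pos attach_lower_I_neg attach_J_even attach_J_odd Vstep_Istep_pt Vstep_Istep_back
  Vstep_Istep_side Vstep_Jstep_pt Vstep_Istep_comm Vstep_Jstep_comm attach_lower_J_pos
  attach_lower_J_neg VinvStep_Istep_pt VinvStep_Jstep_pt VinvStep_Istep_back VinvStep_Istep_side
  VinvStep_Istep_comm VinvStep_Jstep_comm Istep_Jstep_comm

variable {S : ℕ → Set (EuclideanSpace ℝ (Fin 3))}
  {B : EuclideanSpace ℝ (Fin 3) → EuclideanSpace ℝ (Fin 3) → Prop}
  {Pc : EuclideanSpace ℝ (Fin 3) → Finset (Fin 3 → ℤ)}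
  {nb : EuclideanSpace ℝ (Fin 3) → (Fin 3 → ℤ) → EuclideanSpace ℝ (Fin 3)}

variable
  (hch : (∀ n : ℕ, ∀ z ∈ S n, (Pc z = fcc3Int ∨ Pc z = hcpInt) ∧
      Set.BijOn (nb z) (↑(Pc z) : Set (Fin 3 → ℤ)) {y | B z y} ∧
      ∀ t ∈ Pc z, ∀ t' ∈ Pc z, (B (nb z t) (nb z t') ↔ sqNormInt (t - t') = 18)) ∧
    (∀ n : ℕ, ∀ z ∈ S (n + 1), ∀ y, B z y → y ∈ S n) ∧
    (∀ n m : ℕ, ∀ x ∈ S n, ∀ y ∈ S m, B x y →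
      ∀ (z z' : EuclideanSpace ℝ (Fin 3)) (t t' u u' : Fin 3 → ℤ),
        (t = 0 ∧ z = x ∨ t ∈ Pc x ∧ z = nb x t) → (t' = 0 ∧ z' = x ∨ t' ∈ Pc x ∧ z' = nb x t') →
        (u = 0 ∧ z = y ∨ u ∈ Pc y ∧ z = nb y u) → (u' = 0 ∧ z' = y ∨ u' ∈ Pc y ∧ z' = nb y u') →
        sqNormInt (u - u') = sqNormInt (t - t')) ∧
    (∀ x y, B x y → B y x))

include hch



/-- **`V⁻¹ ∘ I`, collinearity.**  With `d = (V⁻¹ g).pt` and `d₁ = (V⁻¹ (I g)).pt`, the label of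
`d` at `d₁` is `−(V⁻¹ (I g)).t₁`. [folklore] -/
theorem VinvStep_Istep_back {n : ℕ} {x : (EuclideanSpace ℝ (Fin 3))} (hx : x ∈ S (n + 4)) {t₁ t₂ : Fin 3 → ℤ} {U : Finset (Fin 3 → ℤ)} (hU : IsFrame (Pc x) t₁ t₂ U) (hI : IsFrame (Pc (nb x t₁)) (Istep Pc nb ⟨x, t₁, t₂, U⟩).t₁ (Istep Pc nb ⟨x, t₁, t₂, U⟩).t₂ (Istep Pc nb ⟨x, t₁, t₂, U⟩).U) (hJ : IsFrame (Pc (nb x t₂)) (Jstep Pc nb ⟨x, t₁, t₂, U⟩).t₁ (Jstep Pc nb ⟨x, t₁, t₂, U⟩).t₂ (Jstep Pc nb ⟨x, t₁, t₂, U⟩).U) (hIi : IsFrame (Pc (nb x (-t₁))) (IinvStep Pc nb ⟨x, t₁, t₂, U⟩).t₁ (IinvStep Pc nb ⟨x, t₁, t₂, U⟩).t₂ (IinvStep Pc nb ⟨x, t₁, t₂, U⟩).U) (hJi : IsFrame (Pc (nb x (-t₂))) (JinvStep Pc nb ⟨x, t₁, t₂, U⟩).t₁ (JinvStep Pc nb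 ⟨x, t₁, t₂, U⟩).t₂ (JinvStep Pc nb ⟨x, t₁, t₂, U⟩).U) (hII : IsFrame (Pc (nb (nb x t₁) (Istep Pc nb ⟨x, t₁, t₂, U⟩).t₁)) (Istep Pc nb (Istep Pc nb ⟨x, t₁, t₂, U⟩)).t₁ (Istep Pc nb (Istep Pc nb ⟨x, t₁, t₂, U⟩)).t₂ (Istep Pc nb (Istep Pc nb ⟨x, t₁, t₂, U⟩)).U) (hJI : IsFrame (Pc (nb (nb x t₁) (Istep Pc nb ⟨x, t₁, t₂, U⟩).t₂)) (Jstep Pc nb (Istep Pc nb ⟨x, t₁, t₂, U⟩)).t₁ (Jstep Pc nb (Istep Pc nb ⟨x, t₁, t₂, U⟩)).t₂ (Jstep Pc nb (Istep Pc nb ⟨x, t₁, t₂, U⟩)).U) (hIiI : IsFrame (Pc (nb (nb x t₁) (-(Istep Pc nb ⟨x, t₁, t₂, U⟩).t₁))) (IinvStep Pc nb (Istep Pc nb ⟨x, t₁, t₂, U⟩)).t₁ (IinvStep Pc nb (Istep Pc nb ⟨x, t₁, t₂, U⟩)).t₂ (IinvStep Pc nb (Istep Pc nb ⟨x, t₁,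 t₂, U⟩)).U) (hJiI : IsFrame (Pc (nb (nb x t₁) (-(Istep Pc nb ⟨x, t₁, t₂, U⟩).t₂))) (JinvStep Pc nb (Istep Pc nb ⟨x, t₁, t₂, U⟩)).t₁ (JinvStep Pc nb (Istep Pc nb ⟨x, t₁, t₂, U⟩)).t₂ (JinvStep Pc nb (Istep Pc nb ⟨x, t₁, t₂, U⟩)).U) : zlab Pc nb (VinvStep Pc nb (Istep Pc nb ⟨x, t₁, t₂, U⟩)).pt (VinvStep Pc nb ⟨x, t₁, t₂, U⟩).pt = -(VinvStep Pc nb (Istep Pc nb ⟨x, t₁, t₂, U⟩)).t₁ ∧ nb (VinvStep Pc nb (Istep Pc nb ⟨x, t₁, t₂, U⟩)).pt (-(VinvStep Pc nb (Istep Pc nb ⟨x, t₁, t₂, U⟩)).t₁) = (VinvStep Pc nb ⟨x, t₁, t₂, U⟩).pt := by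
  have hregI := hregI_of_valid (Pc := Pc) (nb := nb) hI
  obtain ⟨hyS, hbxy, hwP, hwx, -, -, -, -, -, -, -, hframe, hparI, -⟩ := Istep_spec hch hx hU hregI
  obtain ⟨hd'L, hdS, hbd, hξP, hξx, hframeVi, -, hbr⟩ := VinvStep_spec hch hx hU hI hJ hIi hJi
  obtain ⟨hpt, hbdd₁, hθ⟩ := VinvStep_Istep_pt hch hx hU hI hJ hIi hJi
  have hPx := pattern_cases hch hx
  have hPy := pattern_cases hch hyS
  obtain ⟨h12, hhex, hUP, -, -⟩ := id hU
  have ht₁ : t₁ ∈ Pc x := hhex (mem_hexLabels_iff.2 (Or.inl rfl))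
  have ht₂ : t₂ ∈ Pc x := hhex (mem_hexLabels_iff.2 (Or.inr (Or.inl rfl)))
  set d' := apexOf t₁ t₂ (lowerCap (Pc x) t₁ t₂ U) with hd'_def
  have hd'P : d' ∈ Pc x := (mem_lowerCap_iff.1 hd'L).1
  have hd'hex : d' ∉ hexLabels t₁ t₂ := (mem_lowerCap_iff.1 hd'L).2.1
  have hVpt : (VinvStep Pc nb ⟨x, t₁, t₂, U⟩).pt = nb x d' := rfl
  rw [hVpt] at *
  set d := nb x d' with hd_def
  -- the frame `I g = ⟨y, a', b', U'⟩` and `V⁻¹` there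
  set a' := (Istep Pc nb ⟨x, t₁, t₂, U⟩).t₁ with ha'
  set b' := (Istep Pc nb ⟨x, t₁, t₂, U⟩).t₂ with hb'
  set U' := (Istep Pc nb ⟨x, t₁, t₂, U⟩).U with hU'
  have hIeq : Istep Pc nb ⟨x, t₁, t₂, U⟩ = ⟨nb x t₁, a', b', U'⟩ := rfl
  rw [hIeq] at hII hJI hIiI hJiI hpt hbdd₁ hθ ⊢
  obtain ⟨hdL'L, hd₁S, hbyd₁, hξ'P, hξ'y, hframeVi', -, hbr'⟩ :=
    VinvStep_spec hch hyS hframe hII hJI hIiI hJiI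
  obtain ⟨h12', hhex', hUP', -, -⟩ := id hframe
  have ha'P : a' ∈ Pc (nb x t₁) := hhex' (mem_hexLabels_iff.2 (Or.inl rfl))
  have hb'P : b' ∈ Pc (nb x t₁) := hhex' (mem_hexLabels_iff.2 (Or.inr (Or.inl rfl)))
  set dL' := apexOf a' b' (lowerCap (Pc (nb x t₁)) a' b' U') with hdL'_def
  have hdL'P : dL' ∈ Pc (nb x t₁) := (mem_lowerCap_iff.1 hdL'L).1
  have hV'pt : (VinvStep Pc nb ⟨nb x t₁, a', b', U'⟩).pt = nb (nb x t₁) dL' := rfl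
  rw [hV'pt] at *
  set d₁ := nb (nb x t₁) dL' with hd₁_def
  set τ₁'' := (VinvStep Pc nb ⟨nb x t₁, a', b', U'⟩).t₁ with hτ₁''_def
  have hPd₁ := pattern_cases hch hd₁S
  have hτ₁''P : τ₁'' ∈ Pc d₁ := hframeVi'.2.1 (mem_hexLabels_iff.2 (Or.inl rfl))
  have hnτ₁''P : -τ₁'' ∈ Pc d₁ :=
    hframeVi'.2.1 (mem_hexLabels_iff.2 (Or.inr (Or.inr (Or.inr (Or.inl rfl)))))
  have Dτ₁'' : sqNormInt τ₁'' = 18 := chart_sqNormInt_eq hch hd₁S hτ₁''P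
  have hα := zlab_spec hch hd₁S hdS (bond_symm hch hbdd₁)
  rcases hbr with ⟨hlp, hUd, hnI, -, hLeq⟩ | ⟨hlp, hUd, hnI, -, hLeq⟩
  · /- letter below `+1`: `d₁ = nb x (d' + t₁)`; the upper cap of `d₁` contains the label of `x` -/
    obtain ⟨hlp', hatt, -⟩ := attach_lower_I_pos hch hx hU hlp hregI
    rw [hIeq] at hatt
    rcases hbr' with ⟨-, hUd₁, hnI', -, -⟩ | ⟨hlp'', -, -, -, -⟩
    swap
    · rw [hlp'] at hlp''; norm_num at hlp''
    obtain ⟨-, -, -, hd1, hd2, -⟩ := pos_form_of_lowerParity hPx hU hlp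
    have hd₁x : nb x (d' + t₁) = d₁ := hatt.symm
    have hyx : nb (nb x t₁) (-a') = x := by
      show nb (nb x t₁) (-(-zlab Pc nb (nb x t₁) x)) = x
      rw [neg_neg]; exact hwx
    have hη'P : zlab Pc nb d₁ (nb x t₁) - τ₁'' ∈ Pc d₁ := hframeVi'.2.2.1 (by rw [hUd₁]; simp)
    have hη' : zlab Pc nb d₁ x = zlab Pc nb d₁ (nb x t₁) - τ₁'' := by
      have h : zlab Pc nb d₁ (nb (nb x t₁) (-a')) = zlab Pc nb d₁ (nb x t₁) - τ₁'' := by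
        rw [← hnI']; exact zlab_nb hch hd₁S hη'P
      rwa [hyx] at h
    have hbxd₁ : B x d₁ := by
      rw [← hd₁x]; exact (nb_mem hch hx hd1).2
    have hbd₁d : B d₁ (nb x d') := bond_symm hch hbdd₁
    have hbd₁y : B d₁ (nb x t₁) := bond_symm hch hbyd₁
    have Dαη' : sqNormInt (zlab Pc nb d₁ d - zlab Pc nb d₁ x) = 18 := by
      rw [hd_def, transfer_nb_centre hch hx hd₁S hbxd₁ hd'P hbd₁d]
      exact chart_sqNormInt_eq hch hx hd'P
    have Dαξ' : sqNormInt (zlab Pc nb d₁ d - zlab Pc nb d₁ (nb x t₁)) = 54 := by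
      rw [hd_def, transfer_nb_nb hch hx hd₁S hbxd₁ hd'P ht₁ hbd₁d hbd₁y, sqNormInt_sub_comm]
      exact (dist_oddCap (Pc x) hPx t₁ ht₁ t₂ ht₂ d' hd'P h12 hhex hd'hex hd1 hd2).2.2.1
    have hαeq : zlab Pc nb d₁ d = -τ₁'' := by
      have h := label_third_vertex (Pc d₁) hPd₁ (zlab Pc nb d₁ (nb x t₁)) hξ'P
        (zlab Pc nb d₁ (nb x t₁) - τ₁'') hη'P _ hα.1
        (by rw [show zlab Pc nb d₁ (nb x t₁) - (zlab Pc nb d₁ (nb x t₁) - τ₁'') = τ₁'' by abel]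
            exact Dτ₁'')
        (by rw [← hη']; exact Dαη') Dαξ'
        (by rw [show zlab Pc nb d₁ (nb x t₁) - τ₁'' - zlab Pc nb d₁ (nb x t₁) = -τ₁'' by abel]
            exact hnτ₁''P)
      rw [h]; abel
    refine ⟨hαeq, ?_⟩
    rw [← hαeq]; exact hα.2
  · /- letter below `−1`: `d = nb y (dL' − a')`; the upper cap of `d₁` contains the label of `IIx` -/
    obtain ⟨hlp', hatt, -⟩ := attach_lower_I_neg hch hx hU hlp hregI
    rw [hIeq] at hatt
    rcases hbr' with ⟨hlp'', -, -, -, -⟩ | ⟨-, hUd₁, hnI', -, -⟩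
    · rw [hlp'] at hlp''; norm_num at hlp''
    obtain ⟨-, -, hdL'hex, hd1', hd2', -⟩ := neg_form_of_lowerParity hPy hframe hlp'
    have hdy : nb (nb x t₁) (dL' - a') = d := hatt
    have hη'P : zlab Pc nb d₁ (nb x t₁) + τ₁'' ∈ Pc d₁ := hframeVi'.2.2.1 (by rw [hUd₁]; simp)
    have hbd₁II : B d₁ (nb (nb x t₁) a') := by
      rw [← hnI']; exact (nb_mem hch hd₁S hη'P).2
    have hη' : zlab Pc nb d₁ (nb (nb x t₁) a') = zlab Pc nb d₁ (nb x t₁) + τ₁'' := by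
      rw [← hnI']; exact zlab_nb hch hd₁S hη'P
    have hbd₁d : B d₁ (nb (nb x t₁) (dL' - a')) := by rw [hdy]; exact bond_symm hch hbdd₁
    have Dαξ' : sqNormInt (zlab Pc nb d₁ d - zlab Pc nb d₁ (nb x t₁)) = 18 := by
      have h := transfer_nb_centre hch hyS hd₁S hbyd₁ hd1' hbd₁d
      rw [hdy] at h
      rw [h]; exact chart_sqNormInt_eq hch hyS hd1'
    have Dαη' : sqNormInt (zlab Pc nb d₁ d - zlab Pc nb d₁ (nb (nb x t₁) a')) = 54 := by
      have h := transfer_nb_nb hch hyS hd₁S hbyd₁ hd1' ha'P hbd₁d hbd₁II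
      rw [hdy] at h
      rw [h]
      exact (dist_evenCap_ca (Pc (nb x t₁)) hPy a' ha'P b' hb'P dL' hdL'P h12' hhex' hdL'hex
        hd1' hd2').1
    have hαeq : zlab Pc nb d₁ d = -τ₁'' := by
      have h := label_third_vertex (Pc d₁) hPd₁ (zlab Pc nb d₁ (nb x t₁) + τ₁'') hη'P
        (zlab Pc nb d₁ (nb x t₁)) hξ'P _ hα.1
        (by rw [show zlab Pc nb d₁ (nb x t₁) + τ₁'' - zlab Pc nb d₁ (nb x t₁) = τ₁'' by abel]
            exact Dτ₁'')
        Dαξ' (by rw [← hη']; exact Dαη')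
        (by rw [show zlab Pc nb d₁ (nb x t₁) - (zlab Pc nb d₁ (nb x t₁) + τ₁'') = -τ₁'' by abel]
            exact hnτ₁''P)
      rw [h]; abel
    refine ⟨hαeq, ?_⟩
    rw [← hαeq]; exact hα.2

/-! ## Registered anchor (closed form) -/

omit hch in
/-- **Closed form of `VinvStep_Istep_back`** (the registered anchor of this file): the section data
`S, B, Pc, nb` and the standing hypothesis written out, the frame packaged as a `ZFrame`
and the validity hypotheses of the transported frames as one quantified clause. [folklore] -/
theorem VinvStep_Istep_back_graded :
    ∀ {S : ℕ → Set (EuclideanSpace ℝ (Fin 3))} {B : EuclideanSpace ℝ (Fin 3) → EuclideanSpace ℝ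
    (Fin 3) → Prop} {Pc : EuclideanSpace ℝ (Fin 3) → Finset (Fin 3 → ℤ)} {nb : EuclideanSpace ℝ
    (Fin 3) → (Fin 3 → ℤ) → EuclideanSpace ℝ (Fin 3)}, ((∀ n : ℕ, ∀ z ∈ S n, (Pc z =
    Summit.AtomisticToContinuum.Crystallization.Theorems.PalmUnimodularRigidityShellsToBarlowChart.fcc3Int
    ∨ Pc z = Literature.Geometry.DiscreteGeometry.hcpInt) ∧ Set.BijOn (nb z) (↑(Pc z) : Set (Fin
    3 → ℤ)) {y | B z y} ∧ ∀ t ∈ Pc z, ∀ t' ∈ Pc z, (B (nb z t) (nb z t') ↔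
    Literature.Geometry.DiscreteGeometry.sqNormInt (t - t') = 18)) ∧ (∀ n : ℕ, ∀ z ∈ S (n + 1),
    ∀ y, B z y → y ∈ S n) ∧ (∀ n m : ℕ, ∀ x ∈ S n, ∀ y ∈ S m, B x y → ∀ (z z' : EuclideanSpace ℝ
    (Fin 3)) (t t' u u' : Fin 3 → ℤ), (t = 0 ∧ z = x ∨ t ∈ Pc x ∧ z = nb x t) → (t' = 0 ∧ z' = x
    ∨ t' ∈ Pc x ∧ z' = nb x t') → (u = 0 ∧ z = y ∨ u ∈ Pc y ∧ z = nb y u) → (u' = 0 ∧ z' = y ∨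
    u' ∈ Pc y ∧ z' = nb y u') → Literature.Geometry.DiscreteGeometry.sqNormInt (u - u') =
    Literature.Geometry.DiscreteGeometry.sqNormInt (t - t')) ∧ (∀ x y, B x y → B y x)) → ∀ (n :
    ℕ) (f :
    Summit.AtomisticToContinuum.Crystallization.Theorems.PalmUnimodularRigidityShellsToBarlowChart.ZFrame),
    f.pt ∈ S (n + 4) → (∀ g :
    Summit.AtomisticToContinuum.Crystallization.Theorems.PalmUnimodularRigidityShellsToBarlowChart.ZFrame,
    g = f ∨ g =
    Summit.AtomisticToContinuum.Crystallization.Theorems.PalmUnimodularRigidityShellsToBarlowChart.Istep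
    Pc nb f ∨ g =
    Summit.AtomisticToContinuum.Crystallization.Theorems.PalmUnimodularRigidityShellsToBarlowChart.Jstep
    Pc nb f ∨ g =
    Summit.AtomisticToContinuum.Crystallization.Theorems.PalmUnimodularRigidityShellsToBarlowChart.IinvStep
    Pc nb f ∨ g =
    Summit.AtomisticToContinuum.Crystallization.Theorems.PalmUnimodularRigidityShellsToBarlowChart.JinvStep
    Pc nb f ∨ g =
    Summit.AtomisticToContinuum.Crystallization.Theorems.PalmUnimodularRigidityShellsToBarlowChart.Istep
    Pc nb
    (Summit.AtomisticToContinuum.Crystallization.Theorems.PalmUnimodularRigidityShellsToBarlowChart.Istep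
    Pc nb f) ∨ g =
    Summit.AtomisticToContinuum.Crystallization.Theorems.PalmUnimodularRigidityShellsToBarlowChart.Jstep
    Pc nb
    (Summit.AtomisticToContinuum.Crystallization.Theorems.PalmUnimodularRigidityShellsToBarlowChart.Istep
    Pc nb f) ∨ g =
    Summit.AtomisticToContinuum.Crystallization.Theorems.PalmUnimodularRigidityShellsToBarlowChart.IinvStep
    Pc nb
    (Summit.AtomisticToContinuum.Crystallization.Theorems.PalmUnimodularRigidityShellsToBarlowChart.Istep
    Pc nb f) ∨ g =
    Summit.AtomisticToContinuum.Crystallization.Theorems.PalmUnimodularRigidityShellsToBarlowChart.JinvStep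
    Pc nb
    (Summit.AtomisticToContinuum.Crystallization.Theorems.PalmUnimodularRigidityShellsToBarlowChart.Istep
    Pc nb f) →
    Summit.AtomisticToContinuum.Crystallization.Theorems.PalmUnimodularRigidityShellsToBarlowChart.IsFrame
    (Pc g.pt) g.t₁ g.t₂ g.U) → nb
    (Summit.AtomisticToContinuum.Crystallization.Theorems.PalmUnimodularRigidityShellsToBarlowChart.VinvStep
    Pc nb
    (Summit.AtomisticToContinuum.Crystallization.Theorems.PalmUnimodularRigidityShellsToBarlowChart.Istep
    Pc nb f)).pt
    (-(Summit.AtomisticToContinuum.Crystallization.Theorems.PalmUnimodularRigidityShellsToBarlowChart.VinvStep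
    Pc nb
    (Summit.AtomisticToContinuum.Crystallization.Theorems.PalmUnimodularRigidityShellsToBarlowChart.Istep
    Pc nb f)).t₁) =
    (Summit.AtomisticToContinuum.Crystallization.Theorems.PalmUnimodularRigidityShellsToBarlowChart.VinvStep
    Pc nb f).pt := by
  intro S B Pc nb hch n f hx hval 
  obtain ⟨x, t₁, t₂, U⟩ := f
  exact (VinvStep_Istep_back hch hx (hval _ (Or.inl rfl)) (hval _ (Or.inr (Or.inl rfl))) (hval _ (Or.inr (Or.inr (Or.inl rfl)))) (hval _ (Or.inr (Or.inr (Or.inr (Or.inl rfl))))) (hval _ (Or.inr (Or.inr (Or.inr (Or.inr (Or.inl rfl)))))) (hval _ (Or.inr (Or.inr (Or.inr (Or.inr (Or.inr (Or.inl rfl))))))) (hval _ (Or.inr (Or.inr (Or.inr (Or.inr (Or.inr (Or.inr (Or.inl rfl)))))))) (hval _ (Or.inr (Or.inr (Or.inr (Or.inr (Or.inr (Or.inr (Or.inr (Or.inl rfl))))))))) (hval _ (Or.inr (Or.inr (Or.inr (Or.inr (Or.inr (Or.inr (Or.inr (Or.inr (rfl))))))))))).2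

end Summit.AtomisticToContinuum.Crystallization.Theorems.SquareWellLayerCakeGapTwelveToBarlow

end
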